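import Summits.ValiantsHypothesis.ValiantsHypothesis.Theorems.KPlusLogSqLawValuativeDoorVirtual
import Summits.ValiantsHypothesis.ValiantsHypothesis.Theorems.KPlusLogSqLawValuativeDoorDominantChain

/-!
# LINE `valuative_door` (crux `WeakLifting`, stmt-ValiantsHypothesis-19561) — `ValRankOneSharp` FOR DISTINCT LETTER EXPONENTS:
# `npEdges ≤ m (K − m)` for the rank-one lacunary determinant, arbitrary minors and scalars, NO dissociation

HONEST FRAMING.  Helper (cell `pub-symmetroid`, seat val-sym-lift-p1 g22, 2026-08-29; `--supports 19561 --as helper`).  The skeleton's conjectured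
calibration target `ValRankOneSharp` (`npEdges ≤ m (K − m)` for ALL rank-one lacunary pencils `Σ_l X^{d_l} ε_l u_l u_lᵀ` over non-archimedean
fields) is PROVED HERE FOR INJECTIVE `d` (pairwise distinct letter exponents).  WHAT IS LEFT of the card's conjecture is precisely the
REPEATED-EXPONENT case — and that residual is NOT calibration: a general symmetric lacunary pencil is a rank-one pencil with `m`-fold repeated
exponents, so the repeated case carries the whole valuative programme (`…ValuativeDoorRankOneLawToMDR`: `ValRankOneLaw` as typed ⇒
`ValMatrixDescartes`).  Compared with
`valRankOneSharpDiss_unfolded` (dissociated `d`: all `m`-subset sums distinct, so each exponent carries ONE Cauchy–Binet term), the new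
difficulty is IN-CLASS CANCELLATION: the coefficient of `X^E` is the class sum `c_E = Σ_{E(S) = E} w_S`, `w_S = ε(S) det(u_S)²`
(`coeff_eq_sum_virtual`), whose valuation may drop below the class maximum.  RESOLUTION: the VIRTUAL points `(E(S), log v(w_S))` form an
exchange system with distinct slopes (`exchange_virtual`), so (`…DominantChain`) at every slope the top tie `J` is UNIQUE (`tieMax_unique`)
— hence its class has a unique maximum, NO cancellation occurs there (`abv_sum_eq_of_unique_max`), and the actual coefficient point of that
class sits ON the virtual upper envelope while every actual point sits weakly below it (`abv_sum_le_of_forall_le`).  Consequently an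
exponent that is dominant for the ACTUAL coefficients at slope `s` is the class of the top tie `J(s)`, and `J(s)` is virtually dominant just
after `s`; `E ↦ J(s_E)` injects the dominant exponents into the virtually dominant sets, of which there are at most `m (K − m) + 1`
(`card_dominant_le`).  Final statement `valRankOneSharpInj_unfolded` = the skeleton's `ValRankOneSharp` with ONE added binder
`Function.Injective d`, in the unfolded `npEdges`/`domCount` currency.  Calibration-class theorem of LINE (V); the content stub
`stub_valRankOneLaw` (stated for all `d`), vW, `WeakLifting` 19561, `MatrixDescartes` 18050 and VP ≠ VNP are NOT touched.
[Dress–Wenzel + elementary ultrametric analysis]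
-/

set_option linter.dupNamespace false
set_option autoImplicit false

namespace Summit.ValiantsHypothesis.ValiantsHypothesis.Theorems.KPlusLogSqLaw.ValDoor

open Polynomial Finset Matrix
open scoped BigOperators Classical

variable {F : Type*} [Field F]

/-! ## §4 The count: actual dominant exponents inject into virtually dominant sets -/

/-- **CORE COUNT — at most `m (K − m) + 1` dominant exponents for INJECTIVE `d`, arbitrary minors and scalars, non-archimedean `v`.**
Each dominant exponent `E` (at slope `s`) is the exponent of the unique top tie `J(s)` of the virtual exchange system at `s` (its class has a
unique maximum, so its actual coefficient is not cancelled and lies on the virtual envelope, which bounds every actual coefficient), and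
`J(s)` is virtually dominant just after `s`; `E ↦ J(s_E)` is injective and `card_dominant_le` bounds its image. [the assembly] -/
theorem domCount_rankOnePencil_le_inj (v : AbsoluteValue F ℝ) (hv : IsNonarchimedean v) (m K : ℕ) (d : Fin K → ℕ)
    (hd : Function.Injective d) (ε : Fin K → F) (u : Fin K → Fin m → F) :
    ((Matrix.det (∑ l, ((X : F[X]) ^ d l) • (ε l • Matrix.vecMulVec (u l) (u l)).map (C : F →+* F[X]))).support.filter
        fun E => ∃ r : ℝ, 0 < r ∧
          ∀ E' ∈ (Matrix.det (∑ l, ((X : F[X]) ^ d l) • (ε l • Matrix.vecMulVec (u l) (u l)).map (C : F →+* F[X]))).support,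
            E' ≠ E →
            v ((Matrix.det (∑ l, ((X : F[X]) ^ d l) • (ε l • Matrix.vecMulVec (u l) (u l)).map (C : F →+* F[X]))).coeff E') * r ^ E'
              < v ((Matrix.det (∑ l, ((X : F[X]) ^ d l) • (ε l • Matrix.vecMulVec (u l) (u l)).map (C : F →+* F[X]))).coeff E) * r ^ E).card
      ≤ m * (K - m) + 1 := by
  set f : F[X] := Matrix.det (∑ l, ((X : F[X]) ^ d l) • (ε l • Matrix.vecMulVec (u l) (u l)).map (C : F →+* F[X])) with hf
  set D := f.support.filter fun E => ∃ r : ℝ, 0 < r ∧ ∀ E' ∈ f.support, E' ≠ E →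
      v (f.coeff E') * r ^ E' < v (f.coeff E) * r ^ E with hD
  -- the virtual exchange system
  set W : Finset (Fin K) → F := fun S => ∑ t ∈ (univ : Finset (Fin m → Fin K)).filter (fun t => StrictMono t ∧ univ.image t = S),
      (∏ i, ε (t i)) * (Matrix.det (Matrix.of fun i j => u (t j) i)) ^ 2 with hW
  set 𝒮 : Finset (Finset (Fin K)) := univ.filter fun S => S.card = m ∧ W S ≠ 0 with h𝒮
  set a : Finset (Fin K) → ℝ := fun S => Real.log (v (W S)) with ha
  have h𝒮mem : ∀ {S : Finset (Fin K)}, S ∈ 𝒮 ↔ S.card = m ∧ W S ≠ 0 := by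
    intro S
    rw [h𝒮, Finset.mem_filter]
    exact ⟨fun h => h.2, fun h => ⟨Finset.mem_univ _, h⟩⟩
  have hcard : ∀ S ∈ 𝒮, S.card = m := fun S hS => (h𝒮mem.1 hS).1
  have hWpos : ∀ S ∈ 𝒮, 0 < v (W S) := fun S hS => v.pos (h𝒮mem.1 hS).2
  have hX : ∀ A ∈ 𝒮, ∀ B ∈ 𝒮, ∀ i ∈ A \ B, ∃ j ∈ B \ A, insert j (A.erase i) ∈ 𝒮 ∧ insert i (B.erase j) ∈ 𝒮 ∧
      a A + a B ≤ a (insert j (A.erase i)) + a (insert i (B.erase j)) := by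
    intro A hA B hB i hi
    obtain ⟨hAc, hA0⟩ := h𝒮mem.1 hA
    obtain ⟨hBc, hB0⟩ := h𝒮mem.1 hB
    obtain ⟨j, hj, hle⟩ := exchange_virtual v hv m K ε u A B hAc hBc hA0 hB0 i hi
    change v (W A) * v (W B) ≤ v (W (insert j (A.erase i))) * v (W (insert i (B.erase j))) at hle
    obtain ⟨hiA, hiB⟩ := Finset.mem_sdiff.1 hi
    obtain ⟨hjB, hjA⟩ := Finset.mem_sdiff.1 hj
    have hposA := hWpos A hA
    have hposB := hWpos B hB
    have hpos : 0 < v (W (insert j (A.erase i))) * v (W (insert i (B.erase j))) := lt_of_lt_of_le (mul_pos hposA hposB) hle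
    have hposA' : 0 < v (W (insert j (A.erase i))) :=
      lt_of_le_of_ne (v.nonneg _) fun h => by rw [← h, zero_mul] at hpos; exact lt_irrefl _ hpos
    have hposB' : 0 < v (W (insert i (B.erase j))) :=
      lt_of_le_of_ne (v.nonneg _) fun h => by rw [← h, mul_zero] at hpos; exact lt_irrefl _ hpos
    refine ⟨j, hj, h𝒮mem.2 ⟨?_, (v.pos_iff).1 hposA'⟩, h𝒮mem.2 ⟨?_, (v.pos_iff).1 hposB'⟩, ?_⟩
    · rw [card_exchange hiA hjA, hAc]
    · rw [card_exchange hjB hiB, hBc]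
    · have h1 := Real.log_le_log (mul_pos hposA hposB) hle
      rw [Real.log_mul hposA.ne' hposB.ne', Real.log_mul hposA'.ne' hposB'.ne'] at h1
      exact h1
  -- class sums: every actual coefficient is the sum of the virtual coefficients of its class
  have hcoeff : ∀ E : ℕ, f.coeff E = ∑ S ∈ (univ : Finset (Finset (Fin K))).filter (fun S => S.card = m ∧ ∑ l ∈ S, d l = E), W S :=
    fun E => coeff_eq_sum_virtual m K d ε u E
  -- (A) every actual coefficient is bounded by a supported virtual one of its class
  have hbound : ∀ E ∈ f.support, ∃ S ∈ 𝒮, ∑ l ∈ S, d l = E ∧ v (f.coeff E) ≤ v (W S) := by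
    intro E hE
    have hne0 := Polynomial.mem_support_iff.1 hE
    rw [hcoeff E] at hne0 ⊢
    have hCne : ((univ : Finset (Finset (Fin K))).filter (fun S => S.card = m ∧ ∑ l ∈ S, d l = E)).Nonempty := by
      rw [Finset.nonempty_iff_ne_empty]
      intro h
      rw [h, Finset.sum_empty] at hne0
      exact hne0 rfl
    obtain ⟨S, hS, hle⟩ := IsNonarchimedean.finset_image_add_of_nonempty hv W hCne
    obtain ⟨-, hSc, hSE⟩ := Finset.mem_filter.1 hS
    have hWS : W S ≠ 0 := by
      intro h0
      rw [h0, map_zero] at hle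
      exact hne0 ((AbsoluteValue.eq_zero v).1 (le_antisymm hle (v.nonneg _)))
    exact ⟨S, h𝒮mem.2 ⟨hSc, hWS⟩, hSE, hle⟩
  -- (B) each dominant exponent is the exponent of a virtually dominant set
  have key : ∀ E ∈ D, ∃ J ∈ 𝒮, ∑ l ∈ J, d l = E ∧
      ∃ t : ℝ, ∀ T ∈ 𝒮, T ≠ J → a T + t * ((∑ l ∈ T, d l : ℕ) : ℝ) < a J + t * ((∑ l ∈ J, d l : ℕ) : ℝ) := by
    intro E hED
    obtain ⟨hEs, hdom⟩ := Finset.mem_filter.1 hED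
    obtain ⟨s, hs⟩ := (exists_dominant_iff_exists_slope v f hEs).1 hdom
    obtain ⟨S₀, hS₀, hS₀E, hS₀le⟩ := hbound E hEs
    -- the virtual top value M at slope s and the top tie J
    have himne : (𝒮.image fun T => a T + s * ((∑ l ∈ T, d l : ℕ) : ℝ)).Nonempty := ⟨_, Finset.mem_image_of_mem _ hS₀⟩
    set M : ℝ := (𝒮.image fun T => a T + s * ((∑ l ∈ T, d l : ℕ) : ℝ)).max' himne with hM
    have hmax : ∀ T ∈ 𝒮, a T + s * ((∑ l ∈ T, d l : ℕ) : ℝ) ≤ M :=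
      fun T hT => Finset.le_max' _ _ (Finset.mem_image_of_mem (fun T => a T + s * ((∑ l ∈ T, d l : ℕ) : ℝ)) hT)
    obtain ⟨Tm, hTm, hTmM⟩ : ∃ Tm ∈ 𝒮, a Tm + s * ((∑ l ∈ Tm, d l : ℕ) : ℝ) = M :=
      Finset.mem_image.1 (Finset.max'_mem _ himne)
    set Tie : Finset (Finset (Fin K)) := 𝒮.filter fun T => a T + s * ((∑ l ∈ T, d l : ℕ) : ℝ) = M with hTie
    obtain ⟨J, hJTie, hJmax⟩ := Finset.exists_max_image Tie (fun T => ∑ l ∈ T, d l) ⟨Tm, Finset.mem_filter.2 ⟨hTm, hTmM⟩⟩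
    obtain ⟨hJ, hJM⟩ := Finset.mem_filter.1 hJTie
    have hJtop : ∀ T ∈ 𝒮, a T + s * ((∑ l ∈ T, d l : ℕ) : ℝ) = M → ∑ l ∈ T, d l ≤ ∑ l ∈ J, d l :=
      fun T hT hTM => hJmax T (Finset.mem_filter.2 ⟨hT, hTM⟩)
    have hJpos := hWpos J hJ
    -- the class of J has a unique maximum at J
    have huniq : ∀ S ∈ (univ : Finset (Finset (Fin K))).filter (fun S => S.card = m ∧ ∑ l ∈ S, d l = ∑ l ∈ J, d l),
        S ≠ J → v (W S) < v (W J) := by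
      intro S hS hSJ
      obtain ⟨-, hSc, hSE⟩ := Finset.mem_filter.1 hS
      by_cases hWS : W S = 0
      · rw [hWS, map_zero]; exact hJpos
      have hS𝒮 : S ∈ 𝒮 := h𝒮mem.2 ⟨hSc, hWS⟩
      have hle : a S ≤ a J := by
        have h1 := hmax S hS𝒮
        rw [← hJM, hSE] at h1
        linarith
      have hne : a S ≠ a J := by
        intro haeq
        have hSM : a S + s * ((∑ l ∈ S, d l : ℕ) : ℝ) = M := by rw [haeq, hSE, hJM]
        refine hSJ (tieMax_unique 𝒮 a d hd m hcard hX s M hmax hS𝒮 hSM (fun T hT hTM => ?_) hJ hJM hJtop)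
        rw [hSE]
        exact hJtop T hT hTM
      have hlt : a S < a J := lt_of_le_of_ne hle hne
      exact (Real.log_lt_log_iff (hWpos S hS𝒮) hJpos).1 hlt
    -- hence no cancellation at the class of J: its actual coefficient has the size of W J
    have hJclass : J ∈ (univ : Finset (Finset (Fin K))).filter (fun S => S.card = m ∧ ∑ l ∈ S, d l = ∑ l ∈ J, d l) :=
      Finset.mem_filter.2 ⟨Finset.mem_univ _, hcard J hJ, rfl⟩
    have hcJ : v (f.coeff (∑ l ∈ J, d l)) = v (W J) := by
      rw [hcoeff]
      exact abv_sum_eq_of_unique_max v hv _ W hJclass huniq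
    have hEJsupp : (∑ l ∈ J, d l) ∈ f.support := by
      rw [Polynomial.mem_support_iff, ← v.pos_iff, hcJ]
      exact hJpos
    -- the exponent of J is E
    have hEJ : ∑ l ∈ J, d l = E := by
      by_contra hne
      have h1 := hs (∑ l ∈ J, d l) hEJsupp hne
      have h2 : Real.log (v (f.coeff E)) ≤ a S₀ :=
        Real.log_le_log (v.pos (Polynomial.mem_support_iff.1 hEs)) hS₀le
      have h3 := hmax S₀ hS₀
      rw [hS₀E] at h3
      rw [hcJ] at h1
      change a J + ((∑ l ∈ J, d l : ℕ) : ℝ) * s < Real.log (v (f.coeff E)) + (E : ℝ) * s at h1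
      have e1 : ((∑ l ∈ J, d l : ℕ) : ℝ) * s = s * ((∑ l ∈ J, d l : ℕ) : ℝ) := mul_comm _ _
      have e2 : (E : ℝ) * s = s * (E : ℝ) := mul_comm _ _
      rw [e1, e2] at h1
      linarith
    refine ⟨J, hJ, hEJ, ?_⟩
    -- J is virtually dominant just after s
    set 𝒰 : Finset (Finset (Fin K)) := 𝒮.filter fun T => ∑ l ∈ J, d l < ∑ l ∈ T, d l with h𝒰
    set c₁ : Finset (Fin K) → ℝ := fun T => (a J - a T) / (((∑ l ∈ T, d l : ℕ) : ℝ) - ((∑ l ∈ J, d l : ℕ) : ℝ)) with hc₁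
    have hc₁gt : ∀ T ∈ 𝒰, s < c₁ T := by
      intro T hT
      obtain ⟨hT𝒮, hTE⟩ := Finset.mem_filter.1 hT
      have hTE' : ((∑ l ∈ J, d l : ℕ) : ℝ) < ((∑ l ∈ T, d l : ℕ) : ℝ) := by exact_mod_cast hTE
      refine (line_lt_iff_lt_cross hTE' s).1 (lt_of_le_of_ne (hJM.symm ▸ hmax T hT𝒮) fun hTM => ?_)
      have := hJtop T hT𝒮 (hTM.trans hJM)
      exact absurd hTE (not_lt.2 this)
    obtain ⟨t, hst, htc⟩ : ∃ t : ℝ, s < t ∧ ∀ T ∈ 𝒰, t < c₁ T := by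
      rcases 𝒰.eq_empty_or_nonempty with h0 | hne
      · exact ⟨s + 1, by linarith, fun T hT => by rw [h0] at hT; exact absurd hT (Finset.notMem_empty T)⟩
      · have himne' : (𝒰.image c₁).Nonempty := hne.image c₁
        obtain ⟨T₁, hT₁, hT₁c⟩ : ∃ T₁ ∈ 𝒰, c₁ T₁ = (𝒰.image c₁).min' himne' :=
          Finset.mem_image.1 (Finset.min'_mem _ himne')
        refine ⟨(s + (𝒰.image c₁).min' himne') / 2, ?_, fun T hT => ?_⟩
        · have := hc₁gt T₁ hT₁
          rw [hT₁c] at this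
          linarith
        · have h1 : (𝒰.image c₁).min' himne' ≤ c₁ T := Finset.min'_le _ _ (Finset.mem_image_of_mem c₁ hT)
          have h2 := hc₁gt T₁ hT₁
          rw [hT₁c] at h2
          linarith
    refine ⟨t, fun T hT hTJ => ?_⟩
    rcases lt_trichotomy (∑ l ∈ T, d l) (∑ l ∈ J, d l) with hlt | heq | hgt
    · have hlt' : ((∑ l ∈ T, d l : ℕ) : ℝ) < ((∑ l ∈ J, d l : ℕ) : ℝ) := by exact_mod_cast hlt
      exact line_lt_of_le_of_lt (hJM.symm ▸ hmax T hT) hlt' hst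
    · -- equal exponents: T is not a tie (the top tie is unique), constant gap
      have hTM : a T + s * ((∑ l ∈ T, d l : ℕ) : ℝ) < M := by
        refine lt_of_le_of_ne (hmax T hT) fun hTM => hTJ ?_
        refine (tieMax_unique 𝒮 a d hd m hcard hX s M hmax hJ hJM hJtop hT hTM fun T' hT' hT'M => ?_).symm
        rw [heq]
        exact hJtop T' hT' hT'M
      rw [← hJM, heq] at hTM
      rw [heq]
      linarith
    · have hgt' : ((∑ l ∈ J, d l : ℕ) : ℝ) < ((∑ l ∈ T, d l : ℕ) : ℝ) := by exact_mod_cast hgt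
      exact (line_lt_iff_lt_cross hgt' t).2 (htc T (Finset.mem_filter.2 ⟨hT, hgt⟩))
  -- (C) count through the injection E ↦ J(s_E)
  choose sel hsel_mem hsel_sum hsel_dom using key
  set TS : ℕ → Finset (Fin K) := fun E => if h : E ∈ D then sel E h else ∅ with hTS
  have hTS_of : ∀ E (h : E ∈ D), TS E = sel E h := by
    intro E h
    rw [hTS]
    simp only [dif_pos h]
  have hTS_inj : Set.InjOn TS (D : Set ℕ) := by
    intro E hE E' hE' h
    have hED : E ∈ D := Finset.mem_coe.1 hE
    have hE'D : E' ∈ D := Finset.mem_coe.1 hE'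
    rw [← hsel_sum E hED, ← hsel_sum E' hE'D, ← hTS_of E hED, ← hTS_of E' hE'D, h]
  have hcardD : D.card = (D.image TS).card := (Finset.card_image_of_injOn hTS_inj).symm
  rw [hcardD]
  refine card_dominant_le 𝒮 a d hd m hcard hX (D.image TS) fun T hT => ?_
  obtain ⟨E, hED, rfl⟩ := Finset.mem_image.1 hT
  rw [hTS_of E hED]
  exact ⟨hsel_mem E hED, hsel_dom E hED⟩

/-! ## §5 `ValRankOneSharp` for injective `d`, in the skeleton's currency -/

/-- **`ValRankOneSharp` FOR PAIRWISE DISTINCT LETTER EXPONENTS** (the skeleton's conjectured calibration target with the single added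
binder `Function.Injective d`; no dissociation, no unit minors, arbitrary scalars): for every field `F` of characteristic zero with a
non-archimedean absolute value `v`, all `m K`, injective `d : Fin K → ℕ`, `ε`, `u`:
`npEdges = domCount − 1 ≤ m · (K − m)` for `det Σ_l X^{d_l} ε_l u_l u_lᵀ`. [assembly] -/
theorem valRankOneSharpInj_unfolded :
    ∀ (F : Type) [Field F] [CharZero F] (v : AbsoluteValue F ℝ), IsNonarchimedean v →
      ∀ (m K : ℕ) (d : Fin K → ℕ) (ε : Fin K → F) (u : Fin K → Fin m → F), Function.Injective d →
        ((Matrix.det (∑ l, ((Polynomial.X : Polynomial F) ^ d l) •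
            (ε l • Matrix.vecMulVec (u l) (u l)).map Polynomial.C)).support.filter fun E => ∃ r : ℝ, 0 < r ∧
            ∀ E' ∈ (Matrix.det (∑ l, ((Polynomial.X : Polynomial F) ^ d l) •
              (ε l • Matrix.vecMulVec (u l) (u l)).map Polynomial.C)).support, E' ≠ E →
              v ((Matrix.det (∑ l, ((Polynomial.X : Polynomial F) ^ d l) •
                (ε l • Matrix.vecMulVec (u l) (u l)).map Polynomial.C)).coeff E') * r ^ E'
              < v ((Matrix.det (∑ l, ((Polynomial.X : Polynomial F) ^ d l) •
                (ε l • Matrix.vecMulVec (u l) (u l)).map Polynomial.C)).coeff E) * r ^ E).card - 1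
          ≤ m * (K - m) := by
  intro F _ _ v hv m K d ε u hd
  exact Nat.sub_le_iff_le_add.2 (domCount_rankOnePencil_le_inj v hv m K d hd ε u)

end Summit.ValiantsHypothesis.ValiantsHypothesis.Theorems.KPlusLogSqLaw.ValDoor
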